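import Literature.Geometry.Symplectic.CircleActionPrimitiveNormalForm
import Literature.Geometry.Symplectic.HamiltonianVectorFieldCompare
import Literature.Geometry.Symplectic.McleanDivisorComplementConvexFourGluing
import Literature.Geometry.Manifold.OpenSubmanifoldMFDeriv
import HarnessLib

/-!
# McLean's normal form on the punctured tube: `(θ - dh)(X_{r²}) = -(r² + 2κ)`

Topic `Literature/Geometry/Symplectic`; proofs file (the glue between the free-circle-action
normal form and the gluing step) of the fact seat of
`Literature.Geometry.Symplectic.mclean_divisorComplement_convex_four` (M. McLean, *The growth
rate of symplectic homology and affine varieties*, GAFA 22 (2012), Lemma 5.17, pp. 36–37).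

Setting (the data a symplectic tubular neighbourhood of the divisor provides, McLean Lemma 5.14
for `k = 1`, in the tree's vocabulary): on a `4`-manifold `N` with a `2`-form `s`
non-degenerate on the open set `W`, a smooth primitive `θ` of `s` on an open set `U ⊇ W`, a free
smooth circle action on `W` (`[MulAction Circle W]`) preserving a smooth function `r2` ("`r²`")
and generated by `-r2/2` (`s(X, ·) = d(-r2/2)`, `X` the fundamental vector field).  Conclusion
(`exists_tube_normalForm`): there are `h : N → ℝ`, `C^∞` at the points of `W`, and a locally
constant `κ : W → ℝ` (the wrapping number) such that for every `x ∈ W` and the Hamiltonian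
vector field `u = X_{r2}` of `r2` at `x` (`s(u, ·) = d r2`),

  `θ_x(u) - d h_x(u) = -(r2(x) + 2κ(x))`,   `κ(x) = θ_x(X) - ½ r2(x) - dh_x(X)`.

This is exactly the positivity input `hpos` of `exists_convex_of_local_correction`
(`McleanDivisorComplementConvexFourGluing.lean`) once `κ < 0` and `r2 < -2κ`.  Proof:
transport `θ`, `s`, `r2` to the open submanifold `W` (inclusions have identity differential,
`OpenSubmanifold.mfderiv_subtype_val`), apply `exists_orbitwise_correction`
(`CircleActionPrimitiveNormalForm.lean`), extend the correction `h` by zero off `W`, and convert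
`X ↦ X_{r2} = -2X` by non-degeneracy (`eq_neg_two_smul_of_momentMap`).

Everything is proved; no definitions, no named facts (D-0026).

## References

* M. McLean, *The growth rate of symplectic homology and affine varieties*, Geom. Funct. Anal. 22
  (2012), Lemma 5.14, Lemma 5.17 (proof, pp. 36–37). [Mclean2012]
-/

noncomputable section

open scoped Manifold ContDiff Topology Real
open Set Function Filter MeasureTheory intervalIntegral
open Literature.Geometry.Kaehler Literature.Geometry.Manifold

namespace Literature.Geometry.Symplectic

variable {N : Type*} [TopologicalSpace N] [T2Space N] [ChartedSpace (EuclideanSpace ℝ (Fin 4)) N]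
  [IsManifold (𝓡 4) ∞ N]

/-! ### Open submanifolds: inclusions have identity differential -/

section Inclusion

variable {U W : TopologicalSpace.Opens N} (hWU : W ≤ U)

omit [T2Space N] [IsManifold (𝓡 4) ∞ N] in
/-- The inclusion of opens `W ≤ U` has identity differential (both inclusions into `N` do).
[folklore] -/
theorem mfderiv_inclusion_apply (x : W) (v : EuclideanSpace ℝ (Fin 4)) :
    mfderiv (𝓡 4) (𝓡 4) (TopologicalSpace.Opens.inclusion hWU) x v = v := by
  have hi : ContMDiff (𝓡 4) (𝓡 4) ∞ (TopologicalSpace.Opens.inclusion hWU) :=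
    contMDiff_inclusion hWU
  have h1 : HasMFDerivAt (𝓡 4) (𝓡 4) (Subtype.val : U → N) (TopologicalSpace.Opens.inclusion hWU x)
      (ContinuousLinearMap.id ℝ (EuclideanSpace ℝ (Fin 4))) :=
    OpenSubmanifold.hasMFDerivAt_subtype_val _
  have h2 : HasMFDerivAt (𝓡 4) (𝓡 4) (TopologicalSpace.Opens.inclusion hWU) x
      (mfderiv (𝓡 4) (𝓡 4) (TopologicalSpace.Opens.inclusion hWU) x) :=
    ((hi x).mdifferentiableAt (by simp)).hasMFDerivAt
  have h3 := h1.comp x h2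
  have h4 : HasMFDerivAt (𝓡 4) (𝓡 4) (Subtype.val : W → N) x
      (ContinuousLinearMap.id ℝ (EuclideanSpace ℝ (Fin 4))) :=
    OpenSubmanifold.hasMFDerivAt_subtype_val _
  have hfun : (Subtype.val : U → N) ∘ TopologicalSpace.Opens.inclusion hWU =
      (Subtype.val : W → N) := by
    funext y; rfl
  rw [hfun] at h3
  have huniq := hasMFDerivAt_unique h3 h4
  have key := congrArg (fun L : EuclideanSpace ℝ (Fin 4) →L[ℝ] EuclideanSpace ℝ (Fin 4) ↦ L v) huniq
  exact key

omit [T2Space N] [IsManifold (𝓡 4) ∞ N] in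
/-- Entrywise: pushing a vector tuple forward along the inclusion does nothing. [folklore] -/
theorem comp_mfderiv_inclusion {k : ℕ} (x : W) (v : Fin k → EuclideanSpace ℝ (Fin 4)) :
    (fun i ↦ mfderiv (𝓡 4) (𝓡 4) (TopologicalSpace.Opens.inclusion hWU) x (v i)) = v := by
  funext i
  exact mfderiv_inclusion_apply hWU x (v i)

omit [T2Space N] [IsManifold (𝓡 4) ∞ N] in
/-- Entrywise: pushing a vector tuple forward along `Subtype.val` does nothing. [folklore] -/
theorem comp_mfderiv_subtype_val {k : ℕ} (x : W) (v : Fin k → EuclideanSpace ℝ (Fin 4)) :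
    (fun i ↦ mfderiv (𝓡 4) (𝓡 4) (Subtype.val : W → N) x (v i)) = v := by
  funext i
  rw [OpenSubmanifold.mfderiv_subtype_val]
  rfl

end Inclusion

/-! ### The normal form -/

/-- **McLean's normal form on the punctured tube** (Lemma 5.17, proof, pp. 36–37, for one
divisor component): see the module docstring.  Hypotheses: `s` non-degenerate on `W`;
`θ` a smooth primitive of `s` on `U ⊇ W`; a free smooth circle action on `W` preserving the
smooth function `r2` and generated by `-r2/2`.  Conclusion: a correction `h` (`C^∞` on `W`) and
a locally constant `κ` on `W` with `(θ - dh)(X_{r2}) = -(r2 + 2κ)` at every point of `W`, where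
`κ = θ(X) - r2/2 - dh(X)`. [cite: Mclean2012, Lemma 5.17 (proof)] -/
theorem exists_tube_normalForm {U W : TopologicalSpace.Opens N} (hWU : W ≤ U)
    (s : MForm (𝓡 4) N ℝ 2)
    (hnd : ∀ x : W, ∀ v : EuclideanSpace ℝ (Fin 4), v ≠ 0 →
      ∃ w : EuclideanSpace ℝ (Fin 4), s (x : N) ![v, w] ≠ 0)
    (θ : MForm (𝓡 4) U ℝ 1) (hθ : IsSmoothForm θ)
    (hdθ : mextDeriv θ = s.pullback (𝓡 4) (Subtype.val : U → N))
    [MulAction Circle W]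
    (hact : ContMDiff ((𝓡 1).prod (𝓡 4)) (𝓡 4) ∞ (fun p : Circle × W => p.1 • p.2))
    (hfree : ∀ (a : Circle) (x : W), a • x = x → a = 1)
    (r2 : N → ℝ) (hr2 : ContMDiff (𝓡 4) 𝓘(ℝ, ℝ) ∞ r2)
    (hinv : ∀ (a : Circle) (x : W), r2 ((a • x : W) : N) = r2 (x : N))
    (hT4 : ∀ (x : W) (w : EuclideanSpace ℝ (Fin 4)),
      s (x : N) ![circleFundVec x, w] =
        mfderiv (𝓡 4) 𝓘(ℝ, ℝ) (fun y : W ↦ -(1 / 2) * r2 (y : N)) x w) :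
    ∃ (h : N → ℝ) (κ : W → ℝ), (∀ x : W, ContMDiffAt (𝓡 4) 𝓘(ℝ, ℝ) ∞ h (x : N)) ∧
      IsLocallyConstant κ ∧
      (∀ x : W, κ x = θ (TopologicalSpace.Opens.inclusion hWU x) ![circleFundVec x] -
        (1 / 2) * r2 (x : N) -
        mextDeriv (MForm.ofFun (𝓡 4) h) (x : N) ![circleFundVec x]) ∧
      ∀ (x : W) (u : EuclideanSpace ℝ (Fin 4)),
        (∀ w : EuclideanSpace ℝ (Fin 4),
          s (x : N) ![u, w] = mfderiv (𝓡 4) 𝓘(ℝ, ℝ) r2 (x : N) w) →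
        θ (TopologicalSpace.Opens.inclusion hWU x) ![u] -
            mextDeriv (MForm.ofFun (𝓡 4) h) (x : N) ![u] =
          -(r2 (x : N) + 2 * κ x) := by
  -- the data on the open submanifold `W`
  set ι : W → U := TopologicalSpace.Opens.inclusion hWU with hι
  have hιs : ContMDiff (𝓡 4) (𝓡 4) ∞ ι := contMDiff_inclusion hWU
  set θW : MForm (𝓡 4) W ℝ 1 := θ.pullback (𝓡 4) ι with hθW
  set σW : MForm (𝓡 4) W ℝ 2 := s.pullback (𝓡 4) (Subtype.val : W → N) with hσW
  set H : W → ℝ := fun y ↦ -(1 / 2) * r2 (y : N) with hH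
  have hθWs : IsSmoothForm θW := (isSmoothForm_iff_smoothAt _).2 fun x ↦
    MForm.SmoothAt.pullback (Eventually.of_forall fun z ↦ hιs z)
      ((isSmoothForm_iff_smoothAt θ).1 hθ _)
  have hθW_apply : ∀ (x : W) (v : Fin 1 → EuclideanSpace ℝ (Fin 4)),
      θW x v = θ (ι x) v := fun x v ↦ by
    simp only [hθW]
    rw [MForm.pullback_apply, comp_mfderiv_inclusion hWU]
  have hσW_apply : ∀ (x : W) (v : Fin 2 → EuclideanSpace ℝ (Fin 4)),
      σW x v = s (x : N) v := fun x v ↦ by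
    simp only [hσW]
    rw [MForm.pullback_apply, comp_mfderiv_subtype_val]
  -- `dθ_W = s_W`
  have hdW : mextDeriv θW = σW := by
    funext x
    have h1 : mextDeriv θW x = (mextDeriv θ).pullback (𝓡 4) ι x :=
      mextDeriv_pullback_apply (Eventually.of_forall fun z ↦ hιs z)
        ((isSmoothForm_iff_smoothAt θ).1 hθ _)
    rw [h1, hdθ]
    ext v
    rw [MForm.pullback_apply, comp_mfderiv_inclusion hWU, MForm.pullback_apply,
      comp_mfderiv_subtype_val, hσW_apply]
  -- `H = -r2/2` is smooth and invariant, and generates the action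
  have hHs : ContMDiff (𝓡 4) 𝓘(ℝ, ℝ) ∞ H :=
    contMDiff_const.mul (hr2.comp contMDiff_subtype_val)
  have hHinv : ∀ (a : Circle) (x : W), H (a • x) = H x := fun a x ↦ by
    simp only [hH, hinv]
  have hT4W : ∀ (x : W) (w : TangentSpace (𝓡 4) x),
      σW x ![circleFundVec x, w] = mfderiv (𝓡 4) 𝓘(ℝ, ℝ) H x w := fun x w ↦ by
    rw [hσW_apply]
    exact hT4 x w
  -- the free-part normal form
  have hF : Module.finrank ℝ (EuclideanSpace ℝ (Fin 3)) + 1 = 4 := by simp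
  obtain ⟨hW, κ, hhW, hκ, hid⟩ :=
    exists_orbitwise_correction (EuclideanSpace ℝ (Fin 3)) hact hfree hF hθWs hdW hHs hHinv hT4W
  -- extend the correction by zero off `W`
  classical
  set h : N → ℝ := fun z ↦ if hz : z ∈ W then hW ⟨z, hz⟩ else 0 with hh
  have hh_val : ∀ x : W, h (x : N) = hW x := fun x ↦ by
    simp only [hh, dif_pos x.2]
  have hhs : ∀ x : W, ContMDiffAt (𝓡 4) 𝓘(ℝ, ℝ) ∞ h (x : N) := fun x ↦ by
    have h1 : ContMDiffAt (𝓡 4) 𝓘(ℝ, ℝ) ∞ (fun y : W ↦ h (y : N)) x := by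
      have hfun : (fun y : W ↦ h (y : N)) = hW := funext hh_val
      rw [hfun]
      exact hhW x
    exact contMDiffAt_subtype_iff.1 h1
  have hdh : ∀ (x : W) (v : EuclideanSpace ℝ (Fin 4)),
      mextDeriv (MForm.ofFun (𝓡 4) h) (x : N) ![v] = mfderiv (𝓡 4) 𝓘(ℝ, ℝ) hW x v := by
    intro x v
    have hmd : MDifferentiableAt (𝓡 4) 𝓘(ℝ, ℝ) h (x : N) := (hhs x).mdifferentiableAt (by simp)
    rw [mextDeriv_ofFun_apply_eq_mfderiv hmd]
    -- `hW = h ∘ val` near `x`, and `val` has identity differential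
    have hcomp : HasMFDerivAt (𝓡 4) 𝓘(ℝ, ℝ) (h ∘ (Subtype.val : W → N)) x
        ((mfderiv (𝓡 4) 𝓘(ℝ, ℝ) h (x : N)).comp
          (ContinuousLinearMap.id ℝ (EuclideanSpace ℝ (Fin 4)))) :=
      hmd.hasMFDerivAt.comp x (OpenSubmanifold.hasMFDerivAt_subtype_val x)
    have hfun : h ∘ (Subtype.val : W → N) = hW := funext hh_val
    rw [hfun] at hcomp
    rw [hcomp.mfderiv]
    rfl
  refine ⟨h, κ, hhs, hκ, ?_, ?_⟩
  · intro x
    have e := hid x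
    rw [hθW_apply] at e
    rw [hdh]
    -- `e : dhW(X) = θ(X) + H x - κ x`
    have e' : (mfderiv (𝓡 4) 𝓘(ℝ, ℝ) hW x (circleFundVec x) : ℝ) =
        θ (ι x) ![circleFundVec x] + (-(1 / 2) * r2 (x : N)) - κ x := e
    show κ x = θ (ι x) ![circleFundVec x] - 1 / 2 * r2 (x : N) -
      @id ℝ (mfderiv (𝓡 4) 𝓘(ℝ, ℝ) hW x (circleFundVec x))
    have e'' : @id ℝ (mfderiv (𝓡 4) 𝓘(ℝ, ℝ) hW x (circleFundVec x)) =
        θ (ι x) ![circleFundVec x] + (-(1 / 2) * r2 (x : N)) - κ x := e'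
    linarith
  · intro x u hu
    -- `u = -2 X`
    set ρ : EuclideanSpace ℝ (Fin 4) → ℝ := fun w ↦ mfderiv (𝓡 4) 𝓘(ℝ, ℝ) r2 (x : N) w with hρ
    have hHd : HasMFDerivAt (𝓡 4) 𝓘(ℝ, ℝ) H x
        ((-(1 / 2) : ℝ) • ((mfderiv (𝓡 4) 𝓘(ℝ, ℝ) r2 (x : N)).comp
          (ContinuousLinearMap.id ℝ (EuclideanSpace ℝ (Fin 4))))) := by
      have h1 : HasMFDerivAt (𝓡 4) 𝓘(ℝ, ℝ) (fun y : W ↦ r2 (y : N)) x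
          ((mfderiv (𝓡 4) 𝓘(ℝ, ℝ) r2 (x : N)).comp
            (ContinuousLinearMap.id ℝ (EuclideanSpace ℝ (Fin 4)))) :=
        ((hr2 _).mdifferentiableAt (by simp)).hasMFDerivAt.comp x
          (OpenSubmanifold.hasMFDerivAt_subtype_val x)
      exact h1.const_smul (-(1 / 2))
    have hX : ∀ w, s (x : N) ![circleFundVec x, w] = -(1 / 2) * ρ w := fun w ↦ by
      rw [hT4 x w, hHd.mfderiv]
      rfl
    have hu' : ∀ w, s (x : N) ![u, w] = ρ w := hu
    have hueq : u = (-2 : ℝ) • circleFundVec x :=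
      eq_neg_two_smul_of_momentMap (s (x : N)) (hnd x) (fun w ↦ hX w) (fun w ↦ hu' w)
    -- evaluate `θ - dh` on `u = -2 X`
    have e := hid x
    rw [hθW_apply] at e
    have e' : @id ℝ (mfderiv (𝓡 4) 𝓘(ℝ, ℝ) hW x (circleFundVec x)) =
        θ (ι x) ![circleFundVec x] + (-(1 / 2) * r2 (x : N)) - κ x := e
    rw [hdh, hueq]
    have hlinθ : θ (ι x) ![(-2 : ℝ) • circleFundVec x] =
        (-2 : ℝ) * θ (ι x) ![circleFundVec x] := by
      have key : ∀ (M : EuclideanSpace ℝ (Fin 4) [⋀^Fin 1]→L[ℝ] ℝ)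
          (X0 : EuclideanSpace ℝ (Fin 4)) (c : ℝ), M ![c • X0] = c * M ![X0] := by
        intro M X0 c
        have h1 : (![c • X0] : Fin 1 → EuclideanSpace ℝ (Fin 4)) =
            Function.update ![X0] 0 (c • X0) := by
          funext i; fin_cases i; rfl
        have h2 : (![X0] : Fin 1 → EuclideanSpace ℝ (Fin 4)) = Function.update ![X0] 0 X0 := by
          funext i; fin_cases i; rfl
        rw [h1, M.map_update_smul, ← h2, smul_eq_mul]
      exact key (θ (ι x)) (circleFundVec x) (-2)
    have hlinh : @id ℝ (mfderiv (𝓡 4) 𝓘(ℝ, ℝ) hW x ((-2 : ℝ) • circleFundVec x)) =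
        (-2 : ℝ) * @id ℝ (mfderiv (𝓡 4) 𝓘(ℝ, ℝ) hW x (circleFundVec x)) := by
      rw [ContinuousLinearMap.map_smul]
      rfl
    show θ (ι x) ![(-2 : ℝ) • circleFundVec x] -
        @id ℝ (mfderiv (𝓡 4) 𝓘(ℝ, ℝ) hW x ((-2 : ℝ) • circleFundVec x)) =
      -(r2 (x : N) + 2 * κ x)
    rw [hlinθ, hlinh]
    linarith

end Literature.Geometry.Symplectic
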